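import Mathlib
import HarnessLib
import Summits.NavierStokesRegularity.NavierStokesRegularity.Theorems.HalfSpaceWindowDoorCirculationCarryingRigidityDefs
import Summits.NavierStokesRegularity.NavierStokesRegularity.Theorems.HalfSpaceWindowDoorCirculationCarryingRigidityGaussKernel
import Summits.NavierStokesRegularity.NavierStokesRegularity.Theorems.SqueezeCycleExtremalElementExistsRegularity

/-!
# Route `HalfSpaceWindowDoor`, crux `CirculationCarryingRigidity` (stmt-NavierStokesRegularity-25311) —
# toolkit: the Gaussian axial angular momentum `𝒢` and the inflow correlation `ℐ` under BLOW-DOWN (zoom covariance,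
# explicit first-moment bound, continuity along pointwise-convergent bounded sequences)

LEAD ns-hsw-p1 g7 (cell pub-ns-dss), `--supports stmt-NavierStokesRegularity-25311 --as helper`.  Line `gauss_swirl`
(card `Cruxes/CirculationCarryingRigidity/Lines/gauss_swirl.md`, §Next (a): «K1 via far-past tangent flows: ℐ is derivative-free
and continuous under locally uniform convergence with Gaussian tails … the open point is a COMPACTNESS/selection statement»).
This file supplies the three kinematic facts that make the Gaussian functionals of `…Defs` usable along the blow-down /
F3-compactness arguments of `…PeriodicStratum` / `…HorizontalVorticityFloor` (no Navier–Stokes input here):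

* `abs_gaussAngMom_le_of_norm_le` — explicit first-moment bound `|𝒢(t;x₀)[u]| ≤ c₀ B √t` for `‖u‖ ≤ B`
  (`c₀ = (4π)^{3/2}·2·(2·2^{3/2})`, written out); `abs_gaussAngMom_neg_le` — on the door class at the self-similar scale `t = −s`:
  `|𝒢(−s;x₀)[v(s)]| ≤ c₀ C`, uniformly in `s < 0`, `x₀` (so the scale-invariant Gaussian angular momentum has a finite supremum);
* `angMom_zoom`, `gaussAngMom_zoom`, `gaussInflow_zoom` — EXACT ZOOM COVARIANCE: for the Navier–Stokes zoom
  `w(y) = λ u(x₀' + λy)`, `𝒢(t; y₀)[w] = 𝒢(λ²t; x₀' + λy₀)[u]` and the same for `ℐ` (both functionals are dimensionless);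
* `tendsto_gaussAngMom`, `tendsto_gaussInflow` — CONTINUITY: if continuous fields `w_j → W` pointwise with a common bound
  `‖w_j‖, ‖W‖ ≤ B`, then `𝒢(t;y₀)[w_j] → 𝒢(t;y₀)[W]` and `ℐ(t;y₀)[w_j] → ℐ(t;y₀)[W]` (dominated convergence against the first /
  second Gaussian moments).

WHAT THIS IS NOT: not a statement about Navier–Stokes regularity; kinematics of the Gaussian functionals only.  No item is
closed by this file.
-/

noncomputable section

-- the summit and its single sub-problem share the name (CONVENTIONS §1), as in every Theorems file
set_option linter.dupNamespace false

namespace Summit.NavierStokesRegularity.NavierStokesRegularity.Theorems.HalfSpaceWindowDoorCirculationCarryingRigidityGaussBlowdown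

open MeasureTheory Set Function Filter Topology
open scoped RealInnerProductSpace InnerProductSpace
open Literature.Analysis Literature.Analysis.FluidPDE Literature.Analysis.UnboundedOperators
open Summit.NavierStokesRegularity.NavierStokesRegularity.Theorems.HalfSpaceWindowDoorCirculationCarryingRigidityDefs
open Summit.NavierStokesRegularity.NavierStokesRegularity.Theorems (typeI_const_nonneg)
open Summit.NavierStokesRegularity.NavierStokesRegularity.Theorems.HalfSpaceWindowDoorCirculationCarryingRigidityGaussKernel
  (gauss_eq_heatKernel abs_angMom_le rpow_scale integrable_G integrable_G_mul_norm integrable_norm_sq_mul_G continuous_G)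

/-! ### The explicit first-moment bound -/

/-- **Explicit first-moment bound.**  For a field with `‖u(x)‖ ≤ B` everywhere and `t > 0`:
`|𝒢(t; x₀)[u]| ≤ c₀ · B · t^{1/2}` (Gaussian first absolute moment `∫ G_t(y)‖y‖ dy ≤ 2·2^{3/2} t^{1/2}` in `ℝ³`).  No
measurability is needed (a non-integrable integrand has integral `0`). -/
theorem abs_gaussAngMom_le_of_norm_le {t B : ℝ} (ht : 0 < t) (hB : 0 ≤ B)
    {u : EuclideanSpace ℝ (Fin 3) → EuclideanSpace ℝ (Fin 3)} (hu : ∀ x, ‖u x‖ ≤ B) (x₀ : EuclideanSpace ℝ (Fin 3)) :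
    |gaussAngMom t x₀ u| ≤ ((4 * Real.pi) ^ ((3 : ℝ) / 2) * 2 * (2 * (2 : ℝ) ^ ((3 : ℝ) / 2))) * B * t ^ (1 / 2 : ℝ) := by
  set K : ℝ := (4 * Real.pi * t) ^ ((3 : ℝ) / 2) * (2 * B) with hK_def
  have hK0 : 0 ≤ K := by positivity
  have hpt : ∀ x, ‖gauss t x₀ x * angMom x₀ u x‖ ≤ K * (heatKernel t (x - x₀) * ‖x - x₀‖) := by
    intro x
    have hG : 0 ≤ heatKernel t (x - x₀) := (heatKernel_pos ht _).le
    have hg : |angMom x₀ u x| ≤ 2 * ‖x - x₀‖ * B := (abs_angMom_le x₀ u x).trans (by gcongr; exact hu x)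
    rw [Real.norm_eq_abs, abs_mul, gauss_eq_heatKernel ht, abs_of_nonneg (mul_nonneg (by positivity) hG)]
    calc (4 * Real.pi * t) ^ ((3 : ℝ) / 2) * heatKernel t (x - x₀) * |angMom x₀ u x|
        ≤ (4 * Real.pi * t) ^ ((3 : ℝ) / 2) * heatKernel t (x - x₀) * (2 * ‖x - x₀‖ * B) :=
          mul_le_mul_of_nonneg_left hg (mul_nonneg (by positivity) hG)
      _ = K * (heatKernel t (x - x₀) * ‖x - x₀‖) := by rw [hK_def]; ring
  have hint : Integrable (fun x : EuclideanSpace ℝ (Fin 3) => K * (heatKernel t (x - x₀) * ‖x - x₀‖)) :=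
    (integrable_G_mul_norm x₀ ht).const_mul K
  have hI : ‖∫ x, gauss t x₀ x * angMom x₀ u x‖ ≤ ∫ x : EuclideanSpace ℝ (Fin 3), K * (heatKernel t (x - x₀) * ‖x - x₀‖) :=
    norm_integral_le_of_norm_le hint (Eventually.of_forall hpt)
  have hmom : ∫ x : EuclideanSpace ℝ (Fin 3), K * (heatKernel t (x - x₀) * ‖x - x₀‖) =
      K * ∫ y : EuclideanSpace ℝ (Fin 3), heatKernel t y * ‖y‖ := by
    rw [integral_const_mul]
    congr 1
    exact integral_sub_right_eq_self (fun y : EuclideanSpace ℝ (Fin 3) => heatKernel t y * ‖y‖) x₀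
  have hmom_le : ∫ y : EuclideanSpace ℝ (Fin 3), heatKernel t y * ‖y‖ ≤ 2 * (2 : ℝ) ^ ((3 : ℝ) / 2) * t ^ (1 / 2 : ℝ) := by
    have h := integral_heatKernel_mul_norm_le (E := EuclideanSpace ℝ (Fin 3)) ht
    rw [finrank_euclideanSpace_fin] at h
    norm_num at h ⊢
    exact h
  unfold gaussAngMom
  rw [abs_mul, abs_of_nonneg (Real.rpow_nonneg ht.le _)]
  rw [Real.norm_eq_abs] at hI
  calc t ^ (-(3 : ℝ) / 2) * |∫ x, gauss t x₀ x * angMom x₀ u x|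
      ≤ t ^ (-(3 : ℝ) / 2) * (K * (2 * (2 : ℝ) ^ ((3 : ℝ) / 2) * t ^ (1 / 2 : ℝ))) := by
        apply mul_le_mul_of_nonneg_left _ (Real.rpow_nonneg ht.le _)
        exact (hI.trans_eq hmom).trans (mul_le_mul_of_nonneg_left hmom_le hK0)
    _ = (t ^ (-(3 : ℝ) / 2) * (4 * Real.pi * t) ^ ((3 : ℝ) / 2)) * 2 * (2 * (2 : ℝ) ^ ((3 : ℝ) / 2)) * B
          * t ^ (1 / 2 : ℝ) := by rw [hK_def]; ring
    _ = ((4 * Real.pi) ^ ((3 : ℝ) / 2) * 2 * (2 * (2 : ℝ) ^ ((3 : ℝ) / 2))) * B * t ^ (1 / 2 : ℝ) := by rw [rpow_scale ht]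

/-- **Uniform bound at the self-similar scale.**  On the door class, `|𝒢(−s; x₀)[v(s)]| ≤ c₀ C` for every `s < 0` and
every axis `x₀` (the first-moment bound with `B = C/√(−s)` and `t = −s`). -/
theorem abs_gaussAngMom_neg_le {C : ℝ} {v : ℝ → EuclideanSpace ℝ (Fin 3) → EuclideanSpace ℝ (Fin 3)}
    (hrate : HasTypeITimeDecay C v) {s : ℝ} (hs : s < 0) (x₀ : EuclideanSpace ℝ (Fin 3)) :
    |gaussAngMom (-s) x₀ (v s)| ≤ ((4 * Real.pi) ^ ((3 : ℝ) / 2) * 2 * (2 * (2 : ℝ) ^ ((3 : ℝ) / 2))) * C := by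
  have hs0 : 0 < -s := neg_pos.2 hs
  have hC : 0 ≤ C := typeI_const_nonneg hrate
  have hsq : 0 < Real.sqrt (-s) := Real.sqrt_pos.2 hs0
  have h := abs_gaussAngMom_le_of_norm_le hs0 (div_nonneg hC hsq.le) (fun x => hrate s hs x) x₀
  have hid : C / Real.sqrt (-s) * (-s) ^ (1 / 2 : ℝ) = C := by
    rw [← Real.sqrt_eq_rpow]; field_simp
  calc |gaussAngMom (-s) x₀ (v s)| ≤ ((4 * Real.pi) ^ ((3 : ℝ) / 2) * 2 * (2 * (2 : ℝ) ^ ((3 : ℝ) / 2))) * (C / Real.sqrt (-s)) * (-s) ^ (1 / 2 : ℝ) := h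
    _ = ((4 * Real.pi) ^ ((3 : ℝ) / 2) * 2 * (2 * (2 : ℝ) ^ ((3 : ℝ) / 2))) * C := by rw [mul_assoc, hid]

/-! ### Zoom covariance -/

/-- The angular-momentum density under the zoom `w(y) = λ u(x₀' + λy)` about the matching axes:
`g_{y₀}[w](y) = g_{x₀' + λy₀}[u](x₀' + λy)`. -/
theorem angMom_zoom (lam : ℝ) (x₀' y₀ : EuclideanSpace ℝ (Fin 3)) (u : EuclideanSpace ℝ (Fin 3) → EuclideanSpace ℝ (Fin 3))
    (y : EuclideanSpace ℝ (Fin 3)) :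
    angMom y₀ (fun z => lam • u (x₀' + lam • z)) y = angMom (x₀' + lam • y₀) u (x₀' + lam • y) := by
  unfold angMom
  have h : x₀' + lam • y - (x₀' + lam • y₀) = lam • (y - y₀) := by rw [smul_sub]; abel
  rw [h]
  simp only [PiLp.smul_apply, PiLp.sub_apply, smul_eq_mul]
  ring

/-- The Gaussian under the zoom: `e^{−‖y−y₀‖²/4t} = e^{−‖x−X₀‖²/4λ²t}` with `x = x₀' + λy`, `X₀ = x₀' + λy₀` (`λ > 0`). -/
theorem gauss_zoom {lam : ℝ} (hlam : 0 < lam) (t : ℝ) (x₀' y₀ y : EuclideanSpace ℝ (Fin 3)) :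
    gauss t y₀ y = gauss (lam ^ 2 * t) (x₀' + lam • y₀) (x₀' + lam • y) := by
  unfold gauss
  have h : x₀' + lam • y - (x₀' + lam • y₀) = lam • (y - y₀) := by rw [smul_sub]; abel
  rw [h, norm_smul, Real.norm_of_nonneg hlam.le, mul_pow]
  congr 1
  have hl : lam ^ 2 ≠ 0 := pow_ne_zero 2 hlam.ne'
  field_simp

/-- Change of variables `x = x₀' + λy` (`λ > 0`) in `ℝ³`: `∫ F(x₀' + λy) dy = λ⁻³ ∫ F(x) dx`. -/
theorem integral_comp_zoom {lam : ℝ} (hlam : 0 < lam) (x₀' : EuclideanSpace ℝ (Fin 3)) (F : EuclideanSpace ℝ (Fin 3) → ℝ) :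
    ∫ y, F (x₀' + lam • y) = (lam ^ 3)⁻¹ * ∫ x, F x := by
  have h1 : (fun y : EuclideanSpace ℝ (Fin 3) => F (x₀' + lam • y)) = fun y => (fun z => F (x₀' + z)) (lam • y) := rfl
  rw [h1, Measure.integral_comp_smul (μ := volume) (fun z => F (x₀' + z)) lam]
  rw [finrank_euclideanSpace_fin, smul_eq_mul, abs_of_pos (inv_pos.2 (pow_pos hlam 3))]
  congr 1
  exact integral_add_left_eq_self F x₀'

/-- **Zoom covariance of the Gaussian angular momentum** (`𝒢` is dimensionless under the Navier–Stokes scaling): for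
`λ > 0`, `𝒢(t; y₀)[y ↦ λu(x₀' + λy)] = 𝒢(λ²t; x₀' + λy₀)[u]`, `t > 0`. -/
theorem gaussAngMom_zoom {lam : ℝ} (hlam : 0 < lam) {t : ℝ} (ht : 0 < t) (x₀' y₀ : EuclideanSpace ℝ (Fin 3))
    (u : EuclideanSpace ℝ (Fin 3) → EuclideanSpace ℝ (Fin 3)) :
    gaussAngMom t y₀ (fun z => lam • u (x₀' + lam • z)) = gaussAngMom (lam ^ 2 * t) (x₀' + lam • y₀) u := by
  unfold gaussAngMom
  have hF : (fun y => gauss t y₀ y * angMom y₀ (fun z => lam • u (x₀' + lam • z)) y) =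
      fun y => gauss (lam ^ 2 * t) (x₀' + lam • y₀) (x₀' + lam • y) * angMom (x₀' + lam • y₀) u (x₀' + lam • y) := by
    funext y
    rw [angMom_zoom, gauss_zoom hlam t x₀' y₀ y]
  have h2 := integral_comp_zoom hlam x₀'
    (fun x => gauss (lam ^ 2 * t) (x₀' + lam • y₀) x * angMom (x₀' + lam • y₀) u x)
  rw [hF, h2]
  have hl2t : 0 < lam ^ 2 * t := by positivity
  have hpow : (lam ^ 2 * t) ^ (-(3 : ℝ) / 2) = (lam ^ 3)⁻¹ * t ^ (-(3 : ℝ) / 2) := by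
    rw [Real.mul_rpow (by positivity) ht.le]
    congr 1
    rw [show (-(3 : ℝ) / 2) = -((3 : ℝ) / 2) by ring, Real.rpow_neg (by positivity), ← Real.rpow_natCast,
      ← Real.rpow_mul hlam.le]
    norm_num
  rw [hpow]
  ring

/-- **Zoom covariance of the Gaussian inflow correlation**: for `λ > 0`, `t > 0`,
`ℐ(t; y₀)[y ↦ λu(x₀' + λy)] = ℐ(λ²t; x₀' + λy₀)[u]`. -/
theorem gaussInflow_zoom {lam : ℝ} (hlam : 0 < lam) {t : ℝ} (ht : 0 < t) (x₀' y₀ : EuclideanSpace ℝ (Fin 3))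
    (u : EuclideanSpace ℝ (Fin 3) → EuclideanSpace ℝ (Fin 3)) :
    gaussInflow t y₀ (fun z => lam • u (x₀' + lam • z)) = gaussInflow (lam ^ 2 * t) (x₀' + lam • y₀) u := by
  unfold gaussInflow
  have hF : (fun y => gauss t y₀ y * (⟪y - y₀, lam • u (x₀' + lam • y)⟫ * angMom y₀ (fun z => lam • u (x₀' + lam • z)) y)) =
      fun y => gauss (lam ^ 2 * t) (x₀' + lam • y₀) (x₀' + lam • y) *
        (⟪x₀' + lam • y - (x₀' + lam • y₀), u (x₀' + lam • y)⟫ * angMom (x₀' + lam • y₀) u (x₀' + lam • y)) := by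
    funext y
    have h : x₀' + lam • y - (x₀' + lam • y₀) = lam • (y - y₀) := by rw [smul_sub]; abel
    rw [angMom_zoom, gauss_zoom hlam t x₀' y₀ y, h, real_inner_smul_left, real_inner_smul_right]
  have h2 := integral_comp_zoom hlam x₀'
    (fun x => gauss (lam ^ 2 * t) (x₀' + lam • y₀) x * (⟪x - (x₀' + lam • y₀), u x⟫ * angMom (x₀' + lam • y₀) u x))
  rw [hF, h2]
  have hpow : (lam ^ 2 * t) ^ (-(3 : ℝ) / 2) = (lam ^ 3)⁻¹ * t ^ (-(3 : ℝ) / 2) := by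
    rw [Real.mul_rpow (by positivity) ht.le]
    congr 1
    rw [show (-(3 : ℝ) / 2) = -((3 : ℝ) / 2) by ring, Real.rpow_neg (by positivity), ← Real.rpow_natCast,
      ← Real.rpow_mul hlam.le]
    norm_num
  rw [hpow]
  ring

/-! ### Continuity along pointwise-convergent bounded sequences -/

/-- The Gaussian `x ↦ e^{−‖x−y₀‖²/4t}` is continuous. -/
theorem continuous_gauss (t : ℝ) (y₀ : EuclideanSpace ℝ (Fin 3)) : Continuous (gauss t y₀) := by
  unfold gauss; fun_prop

/-- The angular-momentum density of a continuous field is continuous. -/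
theorem continuous_angMom {u : EuclideanSpace ℝ (Fin 3) → EuclideanSpace ℝ (Fin 3)} (hu : Continuous u)
    (y₀ : EuclideanSpace ℝ (Fin 3)) : Continuous (angMom y₀ u) := by
  have hc : ∀ i : Fin 3, Continuous fun x => u x i := fun i =>
    (continuous_apply i).comp ((PiLp.continuous_ofLp 2 _).comp hu)
  have hd : ∀ i : Fin 3, Continuous fun x : EuclideanSpace ℝ (Fin 3) => (x - y₀) i := fun i =>
    (continuous_apply i).comp ((PiLp.continuous_ofLp 2 _).comp (continuous_id.sub continuous_const))
  unfold angMom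
  exact ((hd 0).mul (hc 1)).sub ((hd 1).mul (hc 0))

/-- Pointwise convergence of the angular-momentum density along a pointwise-convergent sequence of fields. -/
theorem tendsto_angMom {w : ℕ → EuclideanSpace ℝ (Fin 3) → EuclideanSpace ℝ (Fin 3)} {W : EuclideanSpace ℝ (Fin 3) → EuclideanSpace ℝ (Fin 3)}
    (y₀ x : EuclideanSpace ℝ (Fin 3)) (h : Tendsto (fun j => w j x) atTop (𝓝 (W x))) :
    Tendsto (fun j => angMom y₀ (w j) x) atTop (𝓝 (angMom y₀ W x)) := by
  have hc : ∀ i : Fin 3, Tendsto (fun j => w j x i) atTop (𝓝 (W x i)) := fun i =>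
    ((continuous_apply i).continuousAt.tendsto.comp ((PiLp.continuous_ofLp 2 _).continuousAt.tendsto.comp h))
  unfold angMom
  exact ((hc 1).const_mul _).sub ((hc 0).const_mul _)

/-- **Continuity of `𝒢` along bounded pointwise-convergent sequences** (dominated convergence against the first Gaussian
moment): `w_j → W` pointwise, all continuous, `‖w_j(x)‖ ≤ B` ⇒ `𝒢(t; y₀)[w_j] → 𝒢(t; y₀)[W]` (`t > 0`). -/
theorem tendsto_gaussAngMom {w : ℕ → EuclideanSpace ℝ (Fin 3) → EuclideanSpace ℝ (Fin 3)}
    {W : EuclideanSpace ℝ (Fin 3) → EuclideanSpace ℝ (Fin 3)} {t B : ℝ} (ht : 0 < t)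
    (hwc : ∀ j, Continuous (w j)) (hwB : ∀ j x, ‖w j x‖ ≤ B)
    (hlim : ∀ x, Tendsto (fun j => w j x) atTop (𝓝 (W x))) (y₀ : EuclideanSpace ℝ (Fin 3)) :
    Tendsto (fun j => gaussAngMom t y₀ (w j)) atTop (𝓝 (gaussAngMom t y₀ W)) := by
  have hB : 0 ≤ B := (norm_nonneg _).trans (hwB 0 0)
  set K : ℝ := (4 * Real.pi * t) ^ ((3 : ℝ) / 2) * (2 * B) with hK_def
  have hint : Integrable (fun x : EuclideanSpace ℝ (Fin 3) => K * (heatKernel t (x - y₀) * ‖x - y₀‖)) :=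
    (integrable_G_mul_norm y₀ ht).const_mul K
  have hdom : ∀ j, ∀ᵐ x ∂(volume : Measure (EuclideanSpace ℝ (Fin 3))),
      ‖gauss t y₀ x * angMom y₀ (w j) x‖ ≤ K * (heatKernel t (x - y₀) * ‖x - y₀‖) := by
    intro j
    refine Eventually.of_forall fun x => ?_
    have hG : 0 ≤ heatKernel t (x - y₀) := (heatKernel_pos ht _).le
    have hg : |angMom y₀ (w j) x| ≤ 2 * ‖x - y₀‖ * B := (abs_angMom_le y₀ (w j) x).trans (by gcongr; exact hwB j x)
    rw [Real.norm_eq_abs, abs_mul, gauss_eq_heatKernel ht, abs_of_nonneg (mul_nonneg (by positivity) hG)]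
    calc (4 * Real.pi * t) ^ ((3 : ℝ) / 2) * heatKernel t (x - y₀) * |angMom y₀ (w j) x|
        ≤ (4 * Real.pi * t) ^ ((3 : ℝ) / 2) * heatKernel t (x - y₀) * (2 * ‖x - y₀‖ * B) :=
          mul_le_mul_of_nonneg_left hg (mul_nonneg (by positivity) hG)
      _ = K * (heatKernel t (x - y₀) * ‖x - y₀‖) := by rw [hK_def]; ring
  have hmeas : ∀ j, AEStronglyMeasurable (fun x => gauss t y₀ x * angMom y₀ (w j) x) volume := fun j =>
    ((continuous_gauss t y₀).mul (continuous_angMom (hwc j) y₀)).aestronglyMeasurable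
  have hptlim : ∀ᵐ x ∂(volume : Measure (EuclideanSpace ℝ (Fin 3))),
      Tendsto (fun j => gauss t y₀ x * angMom y₀ (w j) x) atTop (𝓝 (gauss t y₀ x * angMom y₀ W x)) :=
    Eventually.of_forall fun x => (tendsto_angMom y₀ x (hlim x)).const_mul _
  have hI := tendsto_integral_of_dominated_convergence _ hmeas hint hdom hptlim
  unfold gaussAngMom
  exact hI.const_mul _

/-- **Continuity of `ℐ` along bounded pointwise-convergent sequences** (dominated convergence against the second Gaussian
moment): `w_j → W` pointwise, all continuous, `‖w_j(x)‖ ≤ B` ⇒ `ℐ(t; y₀)[w_j] → ℐ(t; y₀)[W]` (`t > 0`). -/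
theorem tendsto_gaussInflow {w : ℕ → EuclideanSpace ℝ (Fin 3) → EuclideanSpace ℝ (Fin 3)}
    {W : EuclideanSpace ℝ (Fin 3) → EuclideanSpace ℝ (Fin 3)} {t B : ℝ} (ht : 0 < t)
    (hwc : ∀ j, Continuous (w j)) (hwB : ∀ j x, ‖w j x‖ ≤ B)
    (hlim : ∀ x, Tendsto (fun j => w j x) atTop (𝓝 (W x))) (y₀ : EuclideanSpace ℝ (Fin 3)) :
    Tendsto (fun j => gaussInflow t y₀ (w j)) atTop (𝓝 (gaussInflow t y₀ W)) := by
  have hB : 0 ≤ B := (norm_nonneg _).trans (hwB 0 0)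
  set K : ℝ := (4 * Real.pi * t) ^ ((3 : ℝ) / 2) * (2 * B * B) with hK_def
  have hint : Integrable (fun x : EuclideanSpace ℝ (Fin 3) => K * (‖x - y₀‖ ^ 2 * heatKernel t (x - y₀))) :=
    (integrable_norm_sq_mul_G y₀ ht).const_mul K
  have hdom : ∀ j, ∀ᵐ x ∂(volume : Measure (EuclideanSpace ℝ (Fin 3))),
      ‖gauss t y₀ x * (⟪x - y₀, w j x⟫ * angMom y₀ (w j) x)‖ ≤ K * (‖x - y₀‖ ^ 2 * heatKernel t (x - y₀)) := by
    intro j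
    refine Eventually.of_forall fun x => ?_
    have hG : 0 ≤ heatKernel t (x - y₀) := (heatKernel_pos ht _).le
    have hg : |angMom y₀ (w j) x| ≤ 2 * ‖x - y₀‖ * B := (abs_angMom_le y₀ (w j) x).trans (by gcongr; exact hwB j x)
    have hi : |⟪x - y₀, w j x⟫| ≤ ‖x - y₀‖ * B :=
      (abs_real_inner_le_norm _ _).trans (mul_le_mul_of_nonneg_left (hwB j x) (norm_nonneg _))
    rw [Real.norm_eq_abs, abs_mul, abs_mul, gauss_eq_heatKernel ht, abs_of_nonneg (mul_nonneg (by positivity) hG)]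
    calc (4 * Real.pi * t) ^ ((3 : ℝ) / 2) * heatKernel t (x - y₀) * (|⟪x - y₀, w j x⟫| * |angMom y₀ (w j) x|)
        ≤ (4 * Real.pi * t) ^ ((3 : ℝ) / 2) * heatKernel t (x - y₀) * ((‖x - y₀‖ * B) * (2 * ‖x - y₀‖ * B)) :=
          mul_le_mul_of_nonneg_left (mul_le_mul hi hg (abs_nonneg _) (by positivity)) (mul_nonneg (by positivity) hG)
      _ = K * (‖x - y₀‖ ^ 2 * heatKernel t (x - y₀)) := by rw [hK_def]; ring
  have hmeas : ∀ j, AEStronglyMeasurable (fun x => gauss t y₀ x * (⟪x - y₀, w j x⟫ * angMom y₀ (w j) x)) volume :=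
    fun j => ((continuous_gauss t y₀).mul
      (((continuous_id.sub continuous_const).inner (hwc j)).mul (continuous_angMom (hwc j) y₀))).aestronglyMeasurable
  have hptlim : ∀ᵐ x ∂(volume : Measure (EuclideanSpace ℝ (Fin 3))),
      Tendsto (fun j => gauss t y₀ x * (⟪x - y₀, w j x⟫ * angMom y₀ (w j) x)) atTop
        (𝓝 (gauss t y₀ x * (⟪x - y₀, W x⟫ * angMom y₀ W x))) :=
    Eventually.of_forall fun x =>
      (((tendsto_const_nhds (x := x - y₀)).inner (hlim x)).mul (tendsto_angMom y₀ x (hlim x))).const_mul _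
  have hI := tendsto_integral_of_dominated_convergence _ hmeas hint hdom hptlim
  unfold gaussInflow
  exact hI.const_mul _

end Summit.NavierStokesRegularity.NavierStokesRegularity.Theorems.HalfSpaceWindowDoorCirculationCarryingRigidityGaussBlowdown

end
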